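/-
Copyright (c) 2026. All rights reserved.
Released under Apache 2.0 license as described in the file LICENSE.
Authors: abc-iut cell, cone prover seat abc-iut-w6-d031 (wave W6, block C).
-/
import Mathlib.CategoryTheory.Equivalence
import Literature.AnabelianGeometry.AbsoluteAnabelian.LogFrobeniusCompatibility
import HarnessLib

/-!
# [AbsTopIII] Definition 5.4 (vii): the twist `Λ_ν` at the vertices of `Γ⃗^log_v` — proofs

S. Mochizuki, *Topics in absolute anabelian geometry III: global reconstruction algorithms*,
J. Math. Sci. Univ. Tokyo 22 (2015) 939–1156 [MochizukiAbsTopIII2015]; locators `p.N` = pages of the author's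
manuscript (`paper:url-5493eb38cbb7`), read on the page: Def 5.4 (iii) p. 126, (v) p. 127, (vii) p. 128 l.−9 – l.−1.

PROOF-ONLY companion (no new definitions) of `LogFrobeniusGraphs.lean` (p404505) and
`LogFrobeniusCompatibility.lean` (p405623), DAG node `AbsTopIII:Def5.4(vii)`. Def 5.4 (vii) reads: "For each edge `ε`
of `Γ⃗^⋉_v` (respectively, `Γ⃗^log_v`) running from a vertex `ν₁` to a vertex `ν₂`, the arrow in the diagram of (iii)
(respectively, (v)) corresponding to `ε` determines a natural transformation
`ι⊞_{v,ε} : λ⊞_{v,ν₁} ∘ Λ_{ν₁} → λ⊞_{v,ν₂}` (respectively, `ι_{v,ε} : λ_{v,ν₁} ∘ Λ_{ν₁} → λ_{v,ν₂}`) — where, for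
each pre-log vertex `ν` of `Γ⃗^log_v`, we take `Λ_ν` to be the
identity functor on `Th•_T[Z]`; for the post-log vertex `ν` of `Γ⃗^log_v`, we take `Λ_ν` to be the log-Frobenius functor
`log•_{T,T}`". The edges are `LogEdge` / `LogEdgeTS`, the natural transformations are the interface data
`LogFrobeniusSetting.iota` / `LogFrobeniusSetting.TSHomotopies.iota`, and `Λ_ν` is `frobeniusTwist log ν.isPostLog`
(equivalently `NonarchVertex.twist`, `ArchVertex.twist`). Here we kernel-check the printed DEFINITIONAL clauses at the
level of the vertices of the two finite graphs:

* `Λ_ν = 𝟭` at EVERY pre-log vertex and `Λ_ν = log` at THE post-log vertex, for `Γ⃗^log_non`, `Γ⃗^log_arc` and in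
  the `LogVertex` form in which `ι⊞_{v,ε}` is typed; the two typings of `Λ_ν` (p404505 / p405623) agree;
* "the post-log vertex": exactly one vertex of each graph is post-log, and it is a SOURCE only — no edge of
  `Γ⃗^log_v` ends at it and its unique edge is the post-log arrow `k~ →(id) k~` (so `Λ = log` enters the
  `ι⊞_{v,ε}` exactly along that one edge, and the codomain `λ⊞_{v,ν₂}` is never twisted, as printed);
* in any `LogFrobeniusSetting` (Def 5.4 (ii): `log•_{T,T} ≅ id`), every `Λ_ν` is naturally isomorphic to the
  identity and is an equivalence, and the domain of `ι⊞_{v,ε}` is `λ⊞_{v,ν₁}` itself off the post-log vertex and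
  `log ⋙ λ⊞_{v,ν₁}` at it.

Refereed pre-IUT anabelian geometry; nothing here bears on [IUTchIII] Cor. 3.12; typed ≠ discharged.
-/

set_option autoImplicit false

universe v u w

open CategoryTheory

namespace Literature.AnabelianGeometry.AbsoluteAnabelian

/-! ## The post-log vertex of `Γ⃗^log_non` and of `Γ⃗^log_arc` -/

namespace NonarchVertex

/-- a vertex of `Γ⃗^log_non` is pre-log iff it is not the post-log vertex ("the other vertices").
[cite: MochizukiAbsTopIII2015, Def 5.4 (iii) p. 126] -/
theorem isPreLog_iff_not_isPostLog (ν : NonarchVertex) : ν.IsPreLog ↔ ¬ ν.IsPostLog := Iff.rfl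

/-- `Γ⃗^log_non` has exactly one post-log vertex ("the first `k~`"). [cite: MochizukiAbsTopIII2015, Def 5.4 (iii) p. 126] -/
theorem existsUnique_isPostLog : ∃! ν : NonarchVertex, ν.IsPostLog := ⟨postLog, rfl, fun _ h => h⟩

/-- the five pre-log vertices of `Γ⃗^log_non`: `𝒪^×_k̄`, `k̄^×`, `k̄`, the second `k~`, `(k̄^×)^pf`.
[cite: MochizukiAbsTopIII2015, Def 5.4 (iii) p. 126] -/
theorem isPreLog_iff (ν : NonarchVertex) :
    ν.IsPreLog ↔ (ν = units ∨ ν = mult ∨ ν = spaceLink ∨ ν = shellCod ∨ ν = perf) := by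
  cases ν <;> decide

end NonarchVertex

namespace NonarchEdge

/-- no arrow of `Γ⃗^log_non` ends at the post-log vertex. [cite: MochizukiAbsTopIII2015, Def 5.4 (iii) p. 126] -/
theorem isPreLog_target {a b : NonarchVertex} (e : NonarchEdge a b) : b.IsPreLog := by
  cases e <;> decide

/-- the only arrow of `Γ⃗^log_non` starting at the post-log vertex ends at the second copy of `k~` (the target of the
shell-arrow) … [cite: MochizukiAbsTopIII2015, Def 5.4 (iii) p. 126] -/
theorem target_eq_shellCod_of_postLog {b : NonarchVertex} (e : NonarchEdge .postLog b) : b = .shellCod := by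
  cases e; rfl

/-- … and it is the post-log arrow `k~ →(id) k~`. [cite: MochizukiAbsTopIII2015, Def 5.4 (iii) p. 126] -/
theorem eq_postLogId (e : NonarchEdge .postLog .shellCod) : e = postLogId := by
  cases e; rfl

/-- the post-log arrow lies in `Γ⃗^⋉_non` (so Def 5.4 (vii) provides `ι⊞_{v,ε}` along it) but not in `Γ⃗^⋊_non`.
[cite: MochizukiAbsTopIII2015, Def 5.4 (iii) p. 126] -/
theorem inLeft_postLogId : (postLogId).InLeft ∧ ¬ (postLogId).InRight := ⟨trivial, fun h => h⟩

/-- the arrow of `Γ⃗^log_non` missing from `Γ⃗^⋉_non` is exactly the space-link arrow `k̄^× ↪ k̄`.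
[cite: MochizukiAbsTopIII2015, Def 5.4 (iii) p. 126] -/
theorem not_inLeft_iff {a b : NonarchVertex} (e : NonarchEdge a b) :
    ¬ e.InLeft ↔ (a = .mult ∧ b = .spaceLink) := by
  cases e <;> simp [InLeft]

end NonarchEdge

namespace ArchVertex

/-- a vertex of `Γ⃗^log_arc` is pre-log iff it is not the post-log vertex. [cite: MochizukiAbsTopIII2015, Def 5.4 (v) p. 127] -/
theorem isPreLog_iff_not_isPostLog (ν : ArchVertex) : ν.IsPreLog ↔ ¬ ν.IsPostLog := Iff.rfl

/-- `Γ⃗^log_arc` has exactly one post-log vertex ("the first `k~`"). [cite: MochizukiAbsTopIII2015, Def 5.4 (v) p. 127] -/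
theorem existsUnique_isPostLog : ∃! ν : ArchVertex, ν.IsPostLog := ⟨postLog, rfl, fun _ h => h⟩

/-- the three pre-log vertices of `Γ⃗^log_arc`: the second `k~`, `k^×`, `k`. [cite: MochizukiAbsTopIII2015, Def 5.4 (v) p. 127] -/
theorem isPreLog_iff (ν : ArchVertex) : ν.IsPreLog ↔ (ν = pre ∨ ν = mult ∨ ν = spaceLink) := by
  cases ν <;> decide

end ArchVertex

namespace ArchEdge

/-- no arrow of `Γ⃗^log_arc` ends at the post-log vertex. [cite: MochizukiAbsTopIII2015, Def 5.4 (v) p. 127] -/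
theorem isPreLog_target {a b : ArchVertex} (e : ArchEdge a b) : b.IsPreLog := by
  cases e <;> decide

/-- the only arrow of `Γ⃗^log_arc` starting at the post-log vertex ends at the second copy of `k~` (the source of the
shell-arrow) … [cite: MochizukiAbsTopIII2015, Def 5.4 (v) p. 127] -/
theorem target_eq_pre_of_postLog {b : ArchVertex} (e : ArchEdge .postLog b) : b = .pre := by
  cases e; rfl

/-- … and it is the post-log arrow `k~ →(id) k~`. [cite: MochizukiAbsTopIII2015, Def 5.4 (v) p. 127] -/
theorem eq_postLogId (e : ArchEdge .postLog .pre) : e = postLogId := by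
  cases e; rfl

end ArchEdge

/-! ## `Λ_ν` at the vertices (Def 5.4 (vii)) -/

section Twist

variable {X : Type u} [Category.{v} X] (log : X ⥤ X)

/-- `Λ_ν = log•_{T,T}` at the post-log vertex of `Γ⃗^log_non`. [cite: MochizukiAbsTopIII2015, Def 5.4 (vii) p. 128] -/
theorem NonarchVertex.twist_postLog : NonarchVertex.postLog.twist log = log := rfl

/-- `Λ_ν` is the identity functor at every pre-log vertex of `Γ⃗^log_non`. [cite: MochizukiAbsTopIII2015, Def 5.4 (vii) p. 128] -/
theorem NonarchVertex.twist_of_isPreLog {ν : NonarchVertex} (h : ν.IsPreLog) : ν.twist log = 𝟭 X := by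
  unfold NonarchVertex.twist
  rw [decide_eq_false (show ¬ ν.IsPostLog from h)]
  rfl

/-- `Λ_ν = log•_{T,T}` at the post-log vertex of `Γ⃗^log_arc`. [cite: MochizukiAbsTopIII2015, Def 5.4 (vii) p. 128] -/
theorem ArchVertex.twist_postLog : ArchVertex.postLog.twist log = log := rfl

/-- `Λ_ν` is the identity functor at every pre-log vertex of `Γ⃗^log_arc`. [cite: MochizukiAbsTopIII2015, Def 5.4 (vii) p. 128] -/
theorem ArchVertex.twist_of_isPreLog {ν : ArchVertex} (h : ν.IsPreLog) : ν.twist log = 𝟭 X := by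
  unfold ArchVertex.twist
  rw [decide_eq_false (show ¬ ν.IsPostLog from h)]
  rfl

/-- the two typings of `Λ_ν` agree at nonarchimedean `v`: the Boolean `LogVertex.isPostLog` of the interface file
feeds `frobeniusTwist` exactly as `NonarchVertex.twist` does. [cite: MochizukiAbsTopIII2015, Def 5.4 (vii) p. 128] -/
theorem frobeniusTwist_isPostLog_nonarch (ν : NonarchVertex) :
    frobeniusTwist log (LogVertex.isPostLog (b := false) ν) = ν.twist log := rfl

/-- the two typings of `Λ_ν` agree at archimedean `v`. [cite: MochizukiAbsTopIII2015, Def 5.4 (vii) p. 128] -/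
theorem frobeniusTwist_isPostLog_arch (ν : ArchVertex) :
    frobeniusTwist log (LogVertex.isPostLog (b := true) ν) = ν.twist log := rfl

/-- "the post-log vertex" of `Γ⃗^log_v`: `ν.isPostLog` holds iff `ν` is `LogVertex.postLog`.
[cite: MochizukiAbsTopIII2015, Def 5.4 (vii) p. 128] -/
theorem LogVertex.isPostLog_eq_true_iff {b : Bool} (ν : LogVertex b) :
    ν.isPostLog = true ↔ ν = LogVertex.postLog b := by
  cases b
  · change NonarchVertex at ν
    change decide (ν = NonarchVertex.postLog) = true ↔ ν = NonarchVertex.postLog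
    exact decide_eq_true_iff
  · change ArchVertex at ν
    change decide (ν = ArchVertex.postLog) = true ↔ ν = ArchVertex.postLog
    exact decide_eq_true_iff

/-- a vertex of `Γ⃗^log_v` is pre-log (`ν.isPostLog = false`) iff it is not the post-log vertex.
[cite: MochizukiAbsTopIII2015, Def 5.4 (vii) p. 128] -/
theorem LogVertex.isPostLog_eq_false_iff {b : Bool} (ν : LogVertex b) :
    ν.isPostLog = false ↔ ν ≠ LogVertex.postLog b := by
  rw [ne_eq, ← LogVertex.isPostLog_eq_true_iff]
  cases ν.isPostLog <;> simp

/-- `Γ⃗^log_v` has exactly one post-log vertex. [cite: MochizukiAbsTopIII2015, Def 5.4 (vii) p. 128] -/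
theorem LogVertex.existsUnique_isPostLog (b : Bool) : ∃! ν : LogVertex b, ν.isPostLog = true := by
  refine ⟨LogVertex.postLog b, (LogVertex.isPostLog_eq_true_iff _).2 rfl, fun ν h => ?_⟩
  exact (LogVertex.isPostLog_eq_true_iff ν).1 h

/-- the space-link vertex is not the post-log vertex (the two vertices whose functors `λ⊞_{v,ν}` are identified in
`D•` are distinct vertices of `Γ⃗^log_v`). [cite: MochizukiAbsTopIII2015, Def 5.4 (iii) p. 126] -/
theorem LogVertex.spaceLink_ne_postLog (b : Bool) : LogVertex.spaceLink b ≠ LogVertex.postLog b := by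
  cases b <;> (intro h; cases h)

/-- `Λ_ν = log•_{T,T}` at the post-log vertex, in the form in which `ι⊞_{v,ε}` is typed.
[cite: MochizukiAbsTopIII2015, Def 5.4 (vii) p. 128] -/
theorem frobeniusTwist_postLog (b : Bool) : frobeniusTwist log (LogVertex.postLog b).isPostLog = log := by
  cases b <;> rfl

/-- `Λ_ν = 𝟭` at every pre-log vertex, in the form in which `ι⊞_{v,ε}` is typed.
[cite: MochizukiAbsTopIII2015, Def 5.4 (vii) p. 128] -/
theorem frobeniusTwist_of_ne_postLog {b : Bool} {ν : LogVertex b} (h : ν ≠ LogVertex.postLog b) :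
    frobeniusTwist log ν.isPostLog = 𝟭 X := by
  rw [(LogVertex.isPostLog_eq_false_iff ν).2 h]
  rfl

/-- `Λ_ν = 𝟭` at the space-link vertex. [cite: MochizukiAbsTopIII2015, Def 5.4 (vii) p. 128] -/
theorem frobeniusTwist_spaceLink (b : Bool) : frobeniusTwist log (LogVertex.spaceLink b).isPostLog = 𝟭 X :=
  frobeniusTwist_of_ne_postLog log (LogVertex.spaceLink_ne_postLog b)

end Twist

/-! ## The admissible edges `ε : ν₁ → ν₂` of Def 5.4 (vii) relative to the post-log vertex -/

namespace LogEdge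

/-- no admissible edge of Def 5.4 (vii) ENDS at the post-log vertex: the codomain `λ⊞_{v,ν₂}` of `ι⊞_{v,ε}` is never
twisted. [cite: MochizukiAbsTopIII2015, Def 5.4 (vii) p. 128] -/
theorem isPostLog_target {b : Bool} {ν₁ ν₂ : LogVertex b} (ε : LogEdge b ν₁ ν₂) : ν₂.isPostLog = false := by
  cases b
  · change NonarchVertex at ν₁ ν₂
    obtain ⟨e, -⟩ := ε
    cases e <;> rfl
  · change ArchVertex at ν₁ ν₂
    change ArchEdge ν₁ ν₂ at ε
    cases ε <;> rfl

/-- the admissible edges starting at the post-log vertex all end at one and the same pre-log vertex (the second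
copy of `k~`): `Λ = log•_{T,T}` enters the `ι⊞_{v,ε}` along the post-log arrow `k~ →(id) k~` only.
[cite: MochizukiAbsTopIII2015, Def 5.4 (vii) p. 128] -/
theorem target_unique_of_postLog {b : Bool} {ν₂ ν₂' : LogVertex b}
    (ε : LogEdge b (LogVertex.postLog b) ν₂) (ε' : LogEdge b (LogVertex.postLog b) ν₂') : ν₂ = ν₂' := by
  cases b
  · change NonarchVertex at ν₂ ν₂'
    obtain ⟨e, -⟩ := ε
    obtain ⟨e', -⟩ := ε'
    exact (NonarchEdge.target_eq_shellCod_of_postLog e).trans (NonarchEdge.target_eq_shellCod_of_postLog e').symm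
  · change ArchVertex at ν₂ ν₂'
    exact (ArchEdge.target_eq_pre_of_postLog ε).trans (ArchEdge.target_eq_pre_of_postLog ε').symm

/-- there IS an admissible edge out of the post-log vertex (the post-log arrow belongs to `Γ⃗^⋉_non`, resp. to
`Γ⃗^log_arc`). [cite: MochizukiAbsTopIII2015, Def 5.4 (vii) p. 128] -/
theorem nonempty_of_postLog (b : Bool) : ∃ ν₂ : LogVertex b, Nonempty (LogEdge b (LogVertex.postLog b) ν₂) := by
  cases b
  · exact ⟨NonarchVertex.shellCod, ⟨⟨NonarchEdge.postLogId, trivial⟩⟩⟩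
  · exact ⟨ArchVertex.pre, ⟨ArchEdge.postLogId⟩⟩

end LogEdge

/-! ## `Λ_ν` in a log-Frobenius setting (Def 5.4 (ii) + (vii)) -/

namespace LogFrobeniusSetting

variable {Vmod : Type w} {isArc : Vmod → Bool} (S : LogFrobeniusSetting Vmod isArc)

/-- every `Λ_ν` is naturally isomorphic to the identity functor of `Th•_T[Z]` (`log•_{T,T} ≅ id`, Def 5.4 (ii)).
[cite: MochizukiAbsTopIII2015, Def 5.4 (vii) p. 128] -/
theorem nonempty_frobeniusTwist_iso_id (c : Bool) : Nonempty (frobeniusTwist S.log c ≅ 𝟭 S.X) := by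
  cases c
  · exact ⟨Iso.refl _⟩
  · exact ⟨S.logIsoId⟩

/-- every `Λ_ν` is an equivalence of categories. [cite: MochizukiAbsTopIII2015, Def 5.4 (vii) p. 128] -/
theorem frobeniusTwist_isEquivalence (c : Bool) : (frobeniusTwist S.log c).IsEquivalence := by
  cases c
  · exact (inferInstance : (𝟭 S.X).IsEquivalence)
  · exact S.log_isEquivalence

/-- off the post-log vertex the domain of `ι⊞_{v,ε}` is `λ⊞_{v,ν₁}` itself.
[cite: MochizukiAbsTopIII2015, Def 5.4 (vii) p. 128] -/
theorem frobeniusTwist_comp_lam_of_ne_postLog (v : Vmod) {ν : LogVertex (isArc v)}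
    (h : ν ≠ LogVertex.postLog (isArc v)) : frobeniusTwist S.log ν.isPostLog ⋙ S.lam v ν = S.lam v ν := by
  rw [frobeniusTwist_of_ne_postLog S.log h]
  exact Functor.id_comp _

/-- at the post-log vertex the domain of `ι⊞_{v,ε}` is `log•_{T,T} ⋙ λ⊞_{v,ν₁}` ("`λ⊞_{v,ν₁} ∘ Λ_{ν₁}`" with
`Λ_{ν₁} = log•_{T,T}`). [cite: MochizukiAbsTopIII2015, Def 5.4 (vii) p. 128] -/
theorem frobeniusTwist_comp_lam_postLog (v : Vmod) :
    frobeniusTwist S.log (LogVertex.postLog (isArc v)).isPostLog ⋙ S.lam v (LogVertex.postLog (isArc v)) =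
      S.log ⋙ S.lam v (LogVertex.postLog (isArc v)) := by
  rw [frobeniusTwist_postLog]

/-- the codomain vertex of any `ι⊞_{v,ε}` carries the untwisted functor: `Λ_{ν₂} = 𝟭`.
[cite: MochizukiAbsTopIII2015, Def 5.4 (vii) p. 128] -/
theorem frobeniusTwist_target (v : Vmod) {ν₁ ν₂ : LogVertex (isArc v)} (ε : LogEdge (isArc v) ν₁ ν₂) :
    frobeniusTwist S.log ν₂.isPostLog = 𝟭 S.X := by
  rw [LogEdge.isPostLog_target ε]
  rfl

end LogFrobeniusSetting

end Literature.AnabelianGeometry.AbsoluteAnabelian
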